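import Literature.Probability.RandomPlanarGeometry.HexSAWStripWidthThreeHatAdjugateProductsII
import HarnessLib

/-!
# The width-three strip, route A (module D «WIDTH-THREE HAT ADJUGATE IDENTITIES»): the adjugate identity `adj P(λ)·P(λ) = det P(λ)·1`
# coefficientwise — `B_{r−4} − B_{r−3}G − q·B_{r−1}(1 + E′) + q·B_rG = t_r·1`, `r = 0, …, 24`

Topic `Literature/Probability/RandomPlanarGeometry` (context: «WIDTH-THREE HAT RECURSION» `HexSAWStripWidthThreeHatRecursion.lean` — the order-four recursion
`D̂(k+4) = G₃D̂(k+3) + q(1+E′)D̂(k+1) − qG₃D̂(k)` (`W3.hatD_three_rec`, `q = x_c⁶y`, `G₃ = W3.gThree y`, `E′ = W3.ePrimeThree`); plan `HOME/pub-sawmu-a-p2/g28/DESIGN-W3-CONVERGENCE.md`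
§2 route A and `g28/annih/ROUTE-A-RECIPE.md`).  Lane «pcv-sawmu» (CriticalPhenomena venture), a-p2 g28.  ROUTE A in one breath: the scalar ("annihilator") recurrence of the hat
bridge sums — every entry of `D̂(k)` satisfies the order-`24` recurrence with polynomial `det P(λ)`, `P(λ) = λ⁴ − λ³G − λq(1 + E′) + qG` — is the adjugate identity
`adj P(λ)·P(λ) = det P(λ)·1` read coefficientwise and telescoped against the recursion; with «CONVERGENCE CRITERION» it gives geometric convergence of `D̂(n)`.
The five modules: A «HAT ADJUGATE» (symbol with free `(x, y, q)` over `Fin 6`, the `21` coefficient matrices `B_j` of `adj P = Σ B_jλ^j`, the `25` coefficients `t_r` of `det P`),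
B/C «HAT ADJUGATE PRODUCTS I/II» (`B_j·G`, `B_j·E′` as literal matrices, `j ≤ 10` / `j ≥ 11`), D «HAT ADJUGATE IDENTITIES» (the `25` coefficient identities), E «HAT ANNIHILATOR»
(telescoping, the link `τ_r = b₁₀t_r`, ★★★★ `hatD_three_geometric`).  All data: kit `gen_annih2.py` (job j303124), re-verified by exact rational arithmetic `g28/annih/polyx.py`
(25/25 identities, 25/25 links).  Source of the frame: R. P. Stanley, EC1 (2012) §4.1 (rational generating functions ⇔ linear recurrences; transfer matrices §4.7).
Nothing below is printed.  Label: LANE DATA/THEOREM (own computation of lane «pcv-sawmu», a-p2 g28, 2026-08-28; not in print).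

## What is proved (namespace `Literature.Probability.RandomPlanarGeometry.SAW.HV.W3`)
* ★ `adjIdentThree_0 … adjIdentThree_24` (terms with `B_j`, `j ∉ [0, 20]`, absent) — each by ONE literal-algebra `simp only` pass (`Matrix.of_add_of/of_sub_of/smul_of`,
  `Matrix.cons_add_cons/cons_sub_cons/smul_cons`, `congrArg Matrix.of`, `Matrix.vecCons_inj`) and `36` `ring`s.
-/

noncomputable section

open Finset Matrix Literature.Probability.LatticeModels Literature.Probability.Percolation

namespace Literature.Probability.RandomPlanarGeometry.SAW

namespace HV

namespace W3

/-! ## The twenty-five coefficient identities -/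

/-- ★ Coefficient of `λ^0` in `adj P(λ)·P(λ) = det P(λ)·1`. [cite: Stanley2012EC1, §4.1 Theorem 4.1.1; lane «pcv-sawmu» a-p2 g28 — own computation] -/
theorem adjIdentThree_0 (x y q : ℝ) :
    q • (bAdjThree0 x y q * gSymThree x y)
      = tDetThree x y q 0 • (1 : Matrix (Fin 6) (Fin 6) ℝ) := by
  rw [bAdjThree0_mul_g, one_fin_six_of]
  simp only [bgThree0, Matrix.smul_of, Matrix.smul_cons, Matrix.smul_empty, smul_eq_mul]
  refine congrArg Matrix.of ?_
  simp only [Matrix.vecCons_inj, and_true]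
  repeat' apply And.intro
  all_goals (simp only [tDetThree]; ring)

/-- ★ Coefficient of `λ^1` in `adj P(λ)·P(λ) = det P(λ)·1`. [cite: Stanley2012EC1, §4.1 Theorem 4.1.1; lane «pcv-sawmu» a-p2 g28 — own computation] -/
theorem adjIdentThree_1 (x y q : ℝ) :
    -(q • (bAdjThree0 x y q * (1 + ePrimeSymThree x))) + q • (bAdjThree1 x y q * gSymThree x y)
      = tDetThree x y q 1 • (1 : Matrix (Fin 6) (Fin 6) ℝ) := by
  rw [Matrix.mul_add, Matrix.mul_one, bAdjThree0_mul_e, bAdjThree1_mul_g, one_fin_six_of]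
  simp only [bAdjThree0, bgThree1, Matrix.of_add_of, Matrix.smul_of, Matrix.neg_of, Matrix.cons_add_cons, Matrix.smul_cons, Matrix.neg_cons, Matrix.smul_empty, Matrix.empty_add_empty, Matrix.neg_empty, smul_eq_mul]
  refine congrArg Matrix.of ?_
  simp only [Matrix.vecCons_inj, and_true]
  repeat' apply And.intro
  all_goals (simp only [tDetThree]; ring)

/-- ★ Coefficient of `λ^2` in `adj P(λ)·P(λ) = det P(λ)·1`. [cite: Stanley2012EC1, §4.1 Theorem 4.1.1; lane «pcv-sawmu» a-p2 g28 — own computation] -/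
theorem adjIdentThree_2 (x y q : ℝ) :
    -(q • (bAdjThree1 x y q * (1 + ePrimeSymThree x))) + q • (bAdjThree2 x y q * gSymThree x y)
      = tDetThree x y q 2 • (1 : Matrix (Fin 6) (Fin 6) ℝ) := by
  rw [Matrix.mul_add, Matrix.mul_one, bAdjThree1_mul_e, bAdjThree2_mul_g, one_fin_six_of]
  simp only [bAdjThree1, bgThree2, Matrix.of_add_of, Matrix.smul_of, Matrix.neg_of, Matrix.cons_add_cons, Matrix.smul_cons, Matrix.neg_cons, Matrix.smul_empty, Matrix.empty_add_empty, Matrix.neg_empty, smul_eq_mul]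
  refine congrArg Matrix.of ?_
  simp only [Matrix.vecCons_inj, and_true]
  repeat' apply And.intro
  all_goals (simp only [tDetThree]; ring)

/-- ★ Coefficient of `λ^3` in `adj P(λ)·P(λ) = det P(λ)·1`. [cite: Stanley2012EC1, §4.1 Theorem 4.1.1; lane «pcv-sawmu» a-p2 g28 — own computation] -/
theorem adjIdentThree_3 (x y q : ℝ) :
    -(bAdjThree0 x y q * gSymThree x y) - q • (bAdjThree2 x y q * (1 + ePrimeSymThree x)) + q • (bAdjThree3 x y q * gSymThree x y)
      = tDetThree x y q 3 • (1 : Matrix (Fin 6) (Fin 6) ℝ) := by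
  rw [Matrix.mul_add, Matrix.mul_one, bAdjThree0_mul_g, bAdjThree2_mul_e, bAdjThree3_mul_g, one_fin_six_of]
  simp only [bgThree0, bAdjThree2, bgThree3, Matrix.of_add_of, Matrix.of_sub_of, Matrix.smul_of, Matrix.neg_of, Matrix.cons_add_cons, Matrix.cons_sub_cons, Matrix.smul_cons, Matrix.neg_cons, Matrix.smul_empty, Matrix.empty_add_empty, Matrix.empty_sub_empty, Matrix.neg_empty, smul_eq_mul]
  refine congrArg Matrix.of ?_
  simp only [Matrix.vecCons_inj, and_true]
  repeat' apply And.intro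
  all_goals (simp only [tDetThree]; ring)

/-- ★ Coefficient of `λ^4` in `adj P(λ)·P(λ) = det P(λ)·1`. [cite: Stanley2012EC1, §4.1 Theorem 4.1.1; lane «pcv-sawmu» a-p2 g28 — own computation] -/
theorem adjIdentThree_4 (x y q : ℝ) :
    bAdjThree0 x y q - bAdjThree1 x y q * gSymThree x y - q • (bAdjThree3 x y q * (1 + ePrimeSymThree x)) + q • (bAdjThree4 x y q * gSymThree x y)
      = tDetThree x y q 4 • (1 : Matrix (Fin 6) (Fin 6) ℝ) := by
  rw [Matrix.mul_add, Matrix.mul_one, bAdjThree1_mul_g, bAdjThree3_mul_e, bAdjThree4_mul_g, one_fin_six_of]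
  simp only [bAdjThree0, bgThree1, bAdjThree3, bgThree4, Matrix.of_add_of, Matrix.of_sub_of, Matrix.smul_of, Matrix.cons_add_cons, Matrix.cons_sub_cons, Matrix.smul_cons, Matrix.smul_empty, Matrix.empty_add_empty, Matrix.empty_sub_empty, smul_eq_mul]
  refine congrArg Matrix.of ?_
  simp only [Matrix.vecCons_inj, and_true]
  repeat' apply And.intro
  all_goals (simp only [tDetThree]; ring)

/-- ★ Coefficient of `λ^5` in `adj P(λ)·P(λ) = det P(λ)·1`. [cite: Stanley2012EC1, §4.1 Theorem 4.1.1; lane «pcv-sawmu» a-p2 g28 — own computation] -/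
theorem adjIdentThree_5 (x y q : ℝ) :
    bAdjThree1 x y q - bAdjThree2 x y q * gSymThree x y - q • (bAdjThree4 x y q * (1 + ePrimeSymThree x)) + q • (bAdjThree5 x y q * gSymThree x y)
      = tDetThree x y q 5 • (1 : Matrix (Fin 6) (Fin 6) ℝ) := by
  rw [Matrix.mul_add, Matrix.mul_one, bAdjThree2_mul_g, bAdjThree4_mul_e, bAdjThree5_mul_g, one_fin_six_of]
  simp only [bAdjThree1, bgThree2, bAdjThree4, bgThree5, Matrix.of_add_of, Matrix.of_sub_of, Matrix.smul_of, Matrix.cons_add_cons, Matrix.cons_sub_cons, Matrix.smul_cons, Matrix.smul_empty, Matrix.empty_add_empty, Matrix.empty_sub_empty, smul_eq_mul]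
  refine congrArg Matrix.of ?_
  simp only [Matrix.vecCons_inj, and_true]
  repeat' apply And.intro
  all_goals (simp only [tDetThree]; ring)

/-- ★ Coefficient of `λ^6` in `adj P(λ)·P(λ) = det P(λ)·1`. [cite: Stanley2012EC1, §4.1 Theorem 4.1.1; lane «pcv-sawmu» a-p2 g28 — own computation] -/
theorem adjIdentThree_6 (x y q : ℝ) :
    bAdjThree2 x y q - bAdjThree3 x y q * gSymThree x y - q • (bAdjThree5 x y q * (1 + ePrimeSymThree x)) + q • (bAdjThree6 x y q * gSymThree x y)
      = tDetThree x y q 6 • (1 : Matrix (Fin 6) (Fin 6) ℝ) := by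
  rw [Matrix.mul_add, Matrix.mul_one, bAdjThree3_mul_g, bAdjThree5_mul_e, bAdjThree6_mul_g, one_fin_six_of]
  simp only [bAdjThree2, bgThree3, bAdjThree5, bgThree6, Matrix.of_add_of, Matrix.of_sub_of, Matrix.smul_of, Matrix.cons_add_cons, Matrix.cons_sub_cons, Matrix.smul_cons, Matrix.smul_empty, Matrix.empty_add_empty, Matrix.empty_sub_empty, smul_eq_mul]
  refine congrArg Matrix.of ?_
  simp only [Matrix.vecCons_inj, and_true]
  repeat' apply And.intro
  all_goals (simp only [tDetThree]; ring)

/-- ★ Coefficient of `λ^7` in `adj P(λ)·P(λ) = det P(λ)·1`. [cite: Stanley2012EC1, §4.1 Theorem 4.1.1; lane «pcv-sawmu» a-p2 g28 — own computation] -/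
theorem adjIdentThree_7 (x y q : ℝ) :
    bAdjThree3 x y q - bAdjThree4 x y q * gSymThree x y - q • (bAdjThree6 x y q * (1 + ePrimeSymThree x)) + q • (bAdjThree7 x y q * gSymThree x y)
      = tDetThree x y q 7 • (1 : Matrix (Fin 6) (Fin 6) ℝ) := by
  rw [Matrix.mul_add, Matrix.mul_one, bAdjThree4_mul_g, bAdjThree6_mul_e, bAdjThree7_mul_g, one_fin_six_of]
  simp only [bAdjThree3, bgThree4, bAdjThree6, bgThree7, Matrix.of_add_of, Matrix.of_sub_of, Matrix.smul_of, Matrix.cons_add_cons, Matrix.cons_sub_cons, Matrix.smul_cons, Matrix.smul_empty, Matrix.empty_add_empty, Matrix.empty_sub_empty, smul_eq_mul]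
  refine congrArg Matrix.of ?_
  simp only [Matrix.vecCons_inj, and_true]
  repeat' apply And.intro
  all_goals (simp only [tDetThree]; ring)

/-- ★ Coefficient of `λ^8` in `adj P(λ)·P(λ) = det P(λ)·1`. [cite: Stanley2012EC1, §4.1 Theorem 4.1.1; lane «pcv-sawmu» a-p2 g28 — own computation] -/
theorem adjIdentThree_8 (x y q : ℝ) :
    bAdjThree4 x y q - bAdjThree5 x y q * gSymThree x y - q • (bAdjThree7 x y q * (1 + ePrimeSymThree x)) + q • (bAdjThree8 x y q * gSymThree x y)
      = tDetThree x y q 8 • (1 : Matrix (Fin 6) (Fin 6) ℝ) := by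
  rw [Matrix.mul_add, Matrix.mul_one, bAdjThree5_mul_g, bAdjThree7_mul_e, bAdjThree8_mul_g, one_fin_six_of]
  simp only [bAdjThree4, bgThree5, bAdjThree7, bgThree8, Matrix.of_add_of, Matrix.of_sub_of, Matrix.smul_of, Matrix.cons_add_cons, Matrix.cons_sub_cons, Matrix.smul_cons, Matrix.smul_empty, Matrix.empty_add_empty, Matrix.empty_sub_empty, smul_eq_mul]
  refine congrArg Matrix.of ?_
  simp only [Matrix.vecCons_inj, and_true]
  repeat' apply And.intro
  all_goals (simp only [tDetThree]; ring)

/-- ★ Coefficient of `λ^9` in `adj P(λ)·P(λ) = det P(λ)·1`. [cite: Stanley2012EC1, §4.1 Theorem 4.1.1; lane «pcv-sawmu» a-p2 g28 — own computation] -/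
theorem adjIdentThree_9 (x y q : ℝ) :
    bAdjThree5 x y q - bAdjThree6 x y q * gSymThree x y - q • (bAdjThree8 x y q * (1 + ePrimeSymThree x)) + q • (bAdjThree9 x y q * gSymThree x y)
      = tDetThree x y q 9 • (1 : Matrix (Fin 6) (Fin 6) ℝ) := by
  rw [Matrix.mul_add, Matrix.mul_one, bAdjThree6_mul_g, bAdjThree8_mul_e, bAdjThree9_mul_g, one_fin_six_of]
  simp only [bAdjThree5, bgThree6, bAdjThree8, bgThree9, Matrix.of_add_of, Matrix.of_sub_of, Matrix.smul_of, Matrix.cons_add_cons, Matrix.cons_sub_cons, Matrix.smul_cons, Matrix.smul_empty, Matrix.empty_add_empty, Matrix.empty_sub_empty, smul_eq_mul]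
  refine congrArg Matrix.of ?_
  simp only [Matrix.vecCons_inj, and_true]
  repeat' apply And.intro
  all_goals (simp only [tDetThree]; ring)

/-- ★ Coefficient of `λ^10` in `adj P(λ)·P(λ) = det P(λ)·1`. [cite: Stanley2012EC1, §4.1 Theorem 4.1.1; lane «pcv-sawmu» a-p2 g28 — own computation] -/
theorem adjIdentThree_10 (x y q : ℝ) :
    bAdjThree6 x y q - bAdjThree7 x y q * gSymThree x y - q • (bAdjThree9 x y q * (1 + ePrimeSymThree x)) + q • (bAdjThree10 x y q * gSymThree x y)
      = tDetThree x y q 10 • (1 : Matrix (Fin 6) (Fin 6) ℝ) := by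
  rw [Matrix.mul_add, Matrix.mul_one, bAdjThree7_mul_g, bAdjThree9_mul_e, bAdjThree10_mul_g, one_fin_six_of]
  simp only [bAdjThree6, bgThree7, bAdjThree9, bgThree10, Matrix.of_add_of, Matrix.of_sub_of, Matrix.smul_of, Matrix.cons_add_cons, Matrix.cons_sub_cons, Matrix.smul_cons, Matrix.smul_empty, Matrix.empty_add_empty, Matrix.empty_sub_empty, smul_eq_mul]
  refine congrArg Matrix.of ?_
  simp only [Matrix.vecCons_inj, and_true]
  repeat' apply And.intro
  all_goals (simp only [tDetThree]; ring)

/-- ★ Coefficient of `λ^11` in `adj P(λ)·P(λ) = det P(λ)·1`. [cite: Stanley2012EC1, §4.1 Theorem 4.1.1; lane «pcv-sawmu» a-p2 g28 — own computation] -/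
theorem adjIdentThree_11 (x y q : ℝ) :
    bAdjThree7 x y q - bAdjThree8 x y q * gSymThree x y - q • (bAdjThree10 x y q * (1 + ePrimeSymThree x)) + q • (bAdjThree11 x y q * gSymThree x y)
      = tDetThree x y q 11 • (1 : Matrix (Fin 6) (Fin 6) ℝ) := by
  rw [Matrix.mul_add, Matrix.mul_one, bAdjThree8_mul_g, bAdjThree10_mul_e, bAdjThree11_mul_g, one_fin_six_of]
  simp only [bAdjThree7, bgThree8, bAdjThree10, bgThree11, Matrix.of_add_of, Matrix.of_sub_of, Matrix.smul_of, Matrix.cons_add_cons, Matrix.cons_sub_cons, Matrix.smul_cons, Matrix.smul_empty, Matrix.empty_add_empty, Matrix.empty_sub_empty, smul_eq_mul]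
  refine congrArg Matrix.of ?_
  simp only [Matrix.vecCons_inj, and_true]
  repeat' apply And.intro
  all_goals (simp only [tDetThree]; ring)

/-- ★ Coefficient of `λ^12` in `adj P(λ)·P(λ) = det P(λ)·1`. [cite: Stanley2012EC1, §4.1 Theorem 4.1.1; lane «pcv-sawmu» a-p2 g28 — own computation] -/
theorem adjIdentThree_12 (x y q : ℝ) :
    bAdjThree8 x y q - bAdjThree9 x y q * gSymThree x y - q • (bAdjThree11 x y q * (1 + ePrimeSymThree x)) + q • (bAdjThree12 x y q * gSymThree x y)
      = tDetThree x y q 12 • (1 : Matrix (Fin 6) (Fin 6) ℝ) := by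
  rw [Matrix.mul_add, Matrix.mul_one, bAdjThree9_mul_g, bAdjThree11_mul_e, bAdjThree12_mul_g, one_fin_six_of]
  simp only [bAdjThree8, bgThree9, bAdjThree11, bgThree12, Matrix.of_add_of, Matrix.of_sub_of, Matrix.smul_of, Matrix.cons_add_cons, Matrix.cons_sub_cons, Matrix.smul_cons, Matrix.smul_empty, Matrix.empty_add_empty, Matrix.empty_sub_empty, smul_eq_mul]
  refine congrArg Matrix.of ?_
  simp only [Matrix.vecCons_inj, and_true]
  repeat' apply And.intro
  all_goals (simp only [tDetThree]; ring)

/-- ★ Coefficient of `λ^13` in `adj P(λ)·P(λ) = det P(λ)·1`. [cite: Stanley2012EC1, §4.1 Theorem 4.1.1; lane «pcv-sawmu» a-p2 g28 — own computation] -/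
theorem adjIdentThree_13 (x y q : ℝ) :
    bAdjThree9 x y q - bAdjThree10 x y q * gSymThree x y - q • (bAdjThree12 x y q * (1 + ePrimeSymThree x)) + q • (bAdjThree13 x y q * gSymThree x y)
      = tDetThree x y q 13 • (1 : Matrix (Fin 6) (Fin 6) ℝ) := by
  rw [Matrix.mul_add, Matrix.mul_one, bAdjThree10_mul_g, bAdjThree12_mul_e, bAdjThree13_mul_g, one_fin_six_of]
  simp only [bAdjThree9, bgThree10, bAdjThree12, bgThree13, Matrix.of_add_of, Matrix.of_sub_of, Matrix.smul_of, Matrix.cons_add_cons, Matrix.cons_sub_cons, Matrix.smul_cons, Matrix.smul_empty, Matrix.empty_add_empty, Matrix.empty_sub_empty, smul_eq_mul]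
  refine congrArg Matrix.of ?_
  simp only [Matrix.vecCons_inj, and_true]
  repeat' apply And.intro
  all_goals (simp only [tDetThree]; ring)

/-- ★ Coefficient of `λ^14` in `adj P(λ)·P(λ) = det P(λ)·1`. [cite: Stanley2012EC1, §4.1 Theorem 4.1.1; lane «pcv-sawmu» a-p2 g28 — own computation] -/
theorem adjIdentThree_14 (x y q : ℝ) :
    bAdjThree10 x y q - bAdjThree11 x y q * gSymThree x y - q • (bAdjThree13 x y q * (1 + ePrimeSymThree x)) + q • (bAdjThree14 x y q * gSymThree x y)
      = tDetThree x y q 14 • (1 : Matrix (Fin 6) (Fin 6) ℝ) := by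
  rw [Matrix.mul_add, Matrix.mul_one, bAdjThree11_mul_g, bAdjThree13_mul_e, bAdjThree14_mul_g, one_fin_six_of]
  simp only [bAdjThree10, bgThree11, bAdjThree13, bgThree14, Matrix.of_add_of, Matrix.of_sub_of, Matrix.smul_of, Matrix.cons_add_cons, Matrix.cons_sub_cons, Matrix.smul_cons, Matrix.smul_empty, Matrix.empty_add_empty, Matrix.empty_sub_empty, smul_eq_mul]
  refine congrArg Matrix.of ?_
  simp only [Matrix.vecCons_inj, and_true]
  repeat' apply And.intro
  all_goals (simp only [tDetThree]; ring)

/-- ★ Coefficient of `λ^15` in `adj P(λ)·P(λ) = det P(λ)·1`. [cite: Stanley2012EC1, §4.1 Theorem 4.1.1; lane «pcv-sawmu» a-p2 g28 — own computation] -/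
theorem adjIdentThree_15 (x y q : ℝ) :
    bAdjThree11 x y q - bAdjThree12 x y q * gSymThree x y - q • (bAdjThree14 x y q * (1 + ePrimeSymThree x)) + q • (bAdjThree15 x y q * gSymThree x y)
      = tDetThree x y q 15 • (1 : Matrix (Fin 6) (Fin 6) ℝ) := by
  rw [Matrix.mul_add, Matrix.mul_one, bAdjThree12_mul_g, bAdjThree14_mul_e, bAdjThree15_mul_g, one_fin_six_of]
  simp only [bAdjThree11, bgThree12, bAdjThree14, bgThree15, Matrix.of_add_of, Matrix.of_sub_of, Matrix.smul_of, Matrix.cons_add_cons, Matrix.cons_sub_cons, Matrix.smul_cons, Matrix.smul_empty, Matrix.empty_add_empty, Matrix.empty_sub_empty, smul_eq_mul]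
  refine congrArg Matrix.of ?_
  simp only [Matrix.vecCons_inj, and_true]
  repeat' apply And.intro
  all_goals (simp only [tDetThree]; ring)

/-- ★ Coefficient of `λ^16` in `adj P(λ)·P(λ) = det P(λ)·1`. [cite: Stanley2012EC1, §4.1 Theorem 4.1.1; lane «pcv-sawmu» a-p2 g28 — own computation] -/
theorem adjIdentThree_16 (x y q : ℝ) :
    bAdjThree12 x y q - bAdjThree13 x y q * gSymThree x y - q • (bAdjThree15 x y q * (1 + ePrimeSymThree x)) + q • (bAdjThree16 x y q * gSymThree x y)
      = tDetThree x y q 16 • (1 : Matrix (Fin 6) (Fin 6) ℝ) := by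
  rw [Matrix.mul_add, Matrix.mul_one, bAdjThree13_mul_g, bAdjThree15_mul_e, bAdjThree16_mul_g, one_fin_six_of]
  simp only [bAdjThree12, bgThree13, bAdjThree15, bgThree16, Matrix.of_add_of, Matrix.of_sub_of, Matrix.smul_of, Matrix.cons_add_cons, Matrix.cons_sub_cons, Matrix.smul_cons, Matrix.smul_empty, Matrix.empty_add_empty, Matrix.empty_sub_empty, smul_eq_mul]
  refine congrArg Matrix.of ?_
  simp only [Matrix.vecCons_inj, and_true]
  repeat' apply And.intro
  all_goals (simp only [tDetThree]; ring)

/-- ★ Coefficient of `λ^17` in `adj P(λ)·P(λ) = det P(λ)·1`. [cite: Stanley2012EC1, §4.1 Theorem 4.1.1; lane «pcv-sawmu» a-p2 g28 — own computation] -/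
theorem adjIdentThree_17 (x y q : ℝ) :
    bAdjThree13 x y q - bAdjThree14 x y q * gSymThree x y - q • (bAdjThree16 x y q * (1 + ePrimeSymThree x)) + q • (bAdjThree17 x y q * gSymThree x y)
      = tDetThree x y q 17 • (1 : Matrix (Fin 6) (Fin 6) ℝ) := by
  rw [Matrix.mul_add, Matrix.mul_one, bAdjThree14_mul_g, bAdjThree16_mul_e, bAdjThree17_mul_g, one_fin_six_of]
  simp only [bAdjThree13, bgThree14, bAdjThree16, bgThree17, Matrix.of_add_of, Matrix.of_sub_of, Matrix.smul_of, Matrix.cons_add_cons, Matrix.cons_sub_cons, Matrix.smul_cons, Matrix.smul_empty, Matrix.empty_add_empty, Matrix.empty_sub_empty, smul_eq_mul]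
  refine congrArg Matrix.of ?_
  simp only [Matrix.vecCons_inj, and_true]
  repeat' apply And.intro
  all_goals (simp only [tDetThree]; ring)

/-- ★ Coefficient of `λ^18` in `adj P(λ)·P(λ) = det P(λ)·1`. [cite: Stanley2012EC1, §4.1 Theorem 4.1.1; lane «pcv-sawmu» a-p2 g28 — own computation] -/
theorem adjIdentThree_18 (x y q : ℝ) :
    bAdjThree14 x y q - bAdjThree15 x y q * gSymThree x y - q • (bAdjThree17 x y q * (1 + ePrimeSymThree x)) + q • (bAdjThree18 x y q * gSymThree x y)
      = tDetThree x y q 18 • (1 : Matrix (Fin 6) (Fin 6) ℝ) := by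
  rw [Matrix.mul_add, Matrix.mul_one, bAdjThree15_mul_g, bAdjThree17_mul_e, bAdjThree18_mul_g, one_fin_six_of]
  simp only [bAdjThree14, bgThree15, bAdjThree17, bgThree18, Matrix.of_add_of, Matrix.of_sub_of, Matrix.smul_of, Matrix.cons_add_cons, Matrix.cons_sub_cons, Matrix.smul_cons, Matrix.smul_empty, Matrix.empty_add_empty, Matrix.empty_sub_empty, smul_eq_mul]
  refine congrArg Matrix.of ?_
  simp only [Matrix.vecCons_inj, and_true]
  repeat' apply And.intro
  all_goals (simp only [tDetThree]; ring)

/-- ★ Coefficient of `λ^19` in `adj P(λ)·P(λ) = det P(λ)·1`. [cite: Stanley2012EC1, §4.1 Theorem 4.1.1; lane «pcv-sawmu» a-p2 g28 — own computation] -/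
theorem adjIdentThree_19 (x y q : ℝ) :
    bAdjThree15 x y q - bAdjThree16 x y q * gSymThree x y - q • (bAdjThree18 x y q * (1 + ePrimeSymThree x)) + q • (bAdjThree19 x y q * gSymThree x y)
      = tDetThree x y q 19 • (1 : Matrix (Fin 6) (Fin 6) ℝ) := by
  rw [Matrix.mul_add, Matrix.mul_one, bAdjThree16_mul_g, bAdjThree18_mul_e, bAdjThree19_mul_g, one_fin_six_of]
  simp only [bAdjThree15, bgThree16, bAdjThree18, bgThree19, Matrix.of_add_of, Matrix.of_sub_of, Matrix.smul_of, Matrix.cons_add_cons, Matrix.cons_sub_cons, Matrix.smul_cons, Matrix.smul_empty, Matrix.empty_add_empty, Matrix.empty_sub_empty, smul_eq_mul]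
  refine congrArg Matrix.of ?_
  simp only [Matrix.vecCons_inj, and_true]
  repeat' apply And.intro
  all_goals (simp only [tDetThree]; ring)

/-- ★ Coefficient of `λ^20` in `adj P(λ)·P(λ) = det P(λ)·1`. [cite: Stanley2012EC1, §4.1 Theorem 4.1.1; lane «pcv-sawmu» a-p2 g28 — own computation] -/
theorem adjIdentThree_20 (x y q : ℝ) :
    bAdjThree16 x y q - bAdjThree17 x y q * gSymThree x y - q • (bAdjThree19 x y q * (1 + ePrimeSymThree x)) + q • (bAdjThree20 x y q * gSymThree x y)
      = tDetThree x y q 20 • (1 : Matrix (Fin 6) (Fin 6) ℝ) := by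
  rw [Matrix.mul_add, Matrix.mul_one, bAdjThree17_mul_g, bAdjThree19_mul_e, bAdjThree20_mul_g, one_fin_six_of]
  simp only [bAdjThree16, bgThree17, bAdjThree19, bgThree20, Matrix.of_add_of, Matrix.of_sub_of, Matrix.smul_of, Matrix.cons_add_cons, Matrix.cons_sub_cons, Matrix.smul_cons, Matrix.smul_empty, Matrix.empty_add_empty, Matrix.empty_sub_empty, smul_eq_mul]
  refine congrArg Matrix.of ?_
  simp only [Matrix.vecCons_inj, and_true]
  repeat' apply And.intro
  all_goals (simp only [tDetThree]; ring)

/-- ★ Coefficient of `λ^21` in `adj P(λ)·P(λ) = det P(λ)·1`. [cite: Stanley2012EC1, §4.1 Theorem 4.1.1; lane «pcv-sawmu» a-p2 g28 — own computation] -/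
theorem adjIdentThree_21 (x y q : ℝ) :
    bAdjThree17 x y q - bAdjThree18 x y q * gSymThree x y - q • (bAdjThree20 x y q * (1 + ePrimeSymThree x))
      = tDetThree x y q 21 • (1 : Matrix (Fin 6) (Fin 6) ℝ) := by
  rw [Matrix.mul_add, Matrix.mul_one, bAdjThree18_mul_g, bAdjThree20_mul_e, one_fin_six_of]
  simp only [bAdjThree17, bgThree18, bAdjThree20, Matrix.of_add_of, Matrix.of_sub_of, Matrix.smul_of, Matrix.cons_add_cons, Matrix.cons_sub_cons, Matrix.smul_cons, Matrix.smul_empty, Matrix.empty_add_empty, Matrix.empty_sub_empty, smul_eq_mul]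
  refine congrArg Matrix.of ?_
  simp only [Matrix.vecCons_inj, and_true]
  repeat' apply And.intro
  all_goals (simp only [tDetThree]; ring)

/-- ★ Coefficient of `λ^22` in `adj P(λ)·P(λ) = det P(λ)·1`. [cite: Stanley2012EC1, §4.1 Theorem 4.1.1; lane «pcv-sawmu» a-p2 g28 — own computation] -/
theorem adjIdentThree_22 (x y q : ℝ) :
    bAdjThree18 x y q - bAdjThree19 x y q * gSymThree x y
      = tDetThree x y q 22 • (1 : Matrix (Fin 6) (Fin 6) ℝ) := by
  rw [bAdjThree19_mul_g, one_fin_six_of]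
  simp only [bAdjThree18, bgThree19, Matrix.of_sub_of, Matrix.smul_of, Matrix.cons_sub_cons, Matrix.smul_cons, Matrix.smul_empty, Matrix.empty_sub_empty, smul_eq_mul]
  refine congrArg Matrix.of ?_
  simp only [Matrix.vecCons_inj, and_true]
  repeat' apply And.intro
  all_goals (simp only [tDetThree]; ring)

/-- ★ Coefficient of `λ^23` in `adj P(λ)·P(λ) = det P(λ)·1`. [cite: Stanley2012EC1, §4.1 Theorem 4.1.1; lane «pcv-sawmu» a-p2 g28 — own computation] -/
theorem adjIdentThree_23 (x y q : ℝ) :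
    bAdjThree19 x y q - bAdjThree20 x y q * gSymThree x y
      = tDetThree x y q 23 • (1 : Matrix (Fin 6) (Fin 6) ℝ) := by
  rw [bAdjThree20_mul_g, one_fin_six_of]
  simp only [bAdjThree19, bgThree20, Matrix.of_sub_of, Matrix.smul_of, Matrix.cons_sub_cons, Matrix.smul_cons, Matrix.smul_empty, Matrix.empty_sub_empty, smul_eq_mul]
  refine congrArg Matrix.of ?_
  simp only [Matrix.vecCons_inj, and_true]
  repeat' apply And.intro
  all_goals (simp only [tDetThree]; ring)

/-- ★ Coefficient of `λ^24` in `adj P(λ)·P(λ) = det P(λ)·1`. [cite: Stanley2012EC1, §4.1 Theorem 4.1.1; lane «pcv-sawmu» a-p2 g28 — own computation] -/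
theorem adjIdentThree_24 (x y q : ℝ) :
    bAdjThree20 x y q
      = tDetThree x y q 24 • (1 : Matrix (Fin 6) (Fin 6) ℝ) := by
  rw [one_fin_six_of]
  simp only [bAdjThree20, Matrix.smul_of, Matrix.smul_cons, Matrix.smul_empty, smul_eq_mul]
  refine congrArg Matrix.of ?_
  simp only [Matrix.vecCons_inj, and_true]
  repeat' apply And.intro
  all_goals (simp only [tDetThree]; ring)

end W3

end HV

end Literature.Probability.RandomPlanarGeometry.SAW
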